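import Literature.Geometry.Lorentzian.MassInequalities
import Literature.Geometry.Lorentzian.FinalState
import HarnessLib

/-!
# Vacuum initial data satisfy the dominant energy condition and have vanishing sources

Bookkeeping for applying the spacetime positive mass theorem
(`Literature.Geometry.Lorentzian.positive_mass_theorem_spacetime`, Eichmair–Huang–Lee–Schoen
2016, Thm. 1) to VACUUM initial data (`InitialDataSet.IsVacuumConstraintSolution`, in particular
to Christodoulou's admissible class `admissibleVacuumData`): the energy density
`μ = (R(h) - |k|² + (tr k)²)/(16π)` and the momentum density `J = (div k - d tr k)/(8π)` vanish
identically, so the dominant energy condition `|J|_h ≤ μ` holds (with equality `0 ≤ 0`) and the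
source-decay hypothesis `HasSourceDecay e D q₀` of the EHLS statement holds on every end for
every rate `q₀ > 0` (the chart readings of `μ` and `J` are the zero function). Everything is
proved; no definitions, no named facts. Bartnik–Isenberg 2004, §2 (the constraint equations
with sources, (2.1)–(2.2)); Eichmair–Huang–Lee–Schoen, J. Eur. Math. Soc. 18 (2016), §2.
-/

noncomputable section

open Asymptotics Filter Bornology
open scoped Manifold ContDiff Topology

namespace Literature.Geometry.Lorentzian

variable {X : Type} [TopologicalSpace X] [ChartedSpace E3 X] [IsManifold (𝓡 3) ∞ X]

namespace InitialDataSet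

/-- **Vacuum data have vanishing energy density**: `μ = (R(h) - |k|² + (tr k)²)/(16π) = 0` when the
Hamiltonian constraint `R(h) - |k|² + (tr k)² = 0` holds. Bartnik–Isenberg 2004, (2.1).
[cite: BartnikIsenberg2004, §2 (2.1)] -/
theorem IsVacuumConstraintSolution.energyDensity_eq_zero {D : InitialDataSet (𝓡 3) X}
    [D.metric.HasLeviCivita] (h : D.IsVacuumConstraintSolution) (x : X) : D.energyDensity x = 0 := by
  rw [energyDensity, (h x).1, zero_div]

/-- **Vacuum data have vanishing momentum density**: `J = (div k - d tr k)/(8π) = 0` when the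
momentum constraint `div k - d tr k = 0` holds. Bartnik–Isenberg 2004, (2.2).
[cite: BartnikIsenberg2004, §2 (2.2)] -/
theorem IsVacuumConstraintSolution.momentumDensity_eq_zero {D : InitialDataSet (𝓡 3) X}
    [D.metric.HasLeviCivita] (h : D.IsVacuumConstraintSolution) (x : X) : D.momentumDensity x = 0 := by
  rw [momentumDensity, (h x).2, smul_zero]

/-- **Vacuum data satisfy the dominant energy condition** `|J|_h ≤ μ` (both sides vanish:
`g⁻¹(0, 0) = 0`). Bartnik–Isenberg 2004, §2 (below (2.2)). [cite: BartnikIsenberg2004, §2] -/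
theorem IsVacuumConstraintSolution.satisfiesDominantEnergyCondition {D : InitialDataSet (𝓡 3) X}
    [D.metric.HasLeviCivita] (h : D.IsVacuumConstraintSolution) : D.SatisfiesDominantEnergyCondition := by
  intro x
  rw [h.momentumDensity_eq_zero x, h.energyDensity_eq_zero x]
  simp [PseudoRiemannianMetric.innerDual]

end InitialDataSet

/-- **The energy density of vacuum data read in the chart of an end is the zero function** (off
the ball it is `μ ∘ Φ = 0`, inside the ball the junk value `0`). Eichmair–Huang–Lee–Schoen 2016,
§2, Def. 3. [cite: EichmairHuangLeeSchoen2016, §2 Def. 3] -/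
theorem energyDensityCoeff_eq_zero_of_isVacuumConstraintSolution (e : AFEnd X)
    {D : InitialDataSet (𝓡 3) X} [D.metric.HasLeviCivita] (h : D.IsVacuumConstraintSolution) :
    energyDensityCoeff e D = fun _ ↦ 0 := by
  funext x
  by_cases hx : e.R < ‖x‖
  · rw [energyDensityCoeff_of_lt e D hx, h.energyDensity_eq_zero]
  · exact energyDensityCoeff_of_not_lt e D hx

/-- **The momentum density components of vacuum data read in the chart of an end are the zero
function.** Eichmair–Huang–Lee–Schoen 2016, §2, Def. 3. [cite: EichmairHuangLeeSchoen2016, §2 Def. 3] -/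
theorem momentumDensityCoeff_eq_zero_of_isVacuumConstraintSolution (e : AFEnd X)
    {D : InitialDataSet (𝓡 3) X} [D.metric.HasLeviCivita] (h : D.IsVacuumConstraintSolution)
    (i : Fin 3) : momentumDensityCoeff e D i = fun _ ↦ 0 := by
  funext x
  by_cases hx : e.R < ‖x‖
  · rw [momentumDensityCoeff_of_lt e D i hx, h.momentumDensity_eq_zero]
    rfl
  · exact momentumDensityCoeff_of_not_lt e D i hx

/-- **Vacuum data have source decay of every positive rate** on every end: the chart readings of
`μ` and `J` vanish identically, so all their iterated derivatives are `0 = O(‖x‖^{-3-q₀-m})`.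
This discharges the hypothesis `∃ q₀, HasSourceDecay e D q₀` of
`positive_mass_theorem_spacetime` / `positive_mass_theorem_riemannian` for vacuum data.
Eichmair–Huang–Lee–Schoen 2016, §2. [cite: EichmairHuangLeeSchoen2016, §2] -/
theorem hasSourceDecay_of_isVacuumConstraintSolution (e : AFEnd X) {D : InitialDataSet (𝓡 3) X}
    [D.metric.HasLeviCivita] (h : D.IsVacuumConstraintSolution) {q₀ : ℝ} (hq₀ : 0 < q₀) :
    HasSourceDecay e D q₀ := by
  refine ⟨hq₀, fun m _ ↦ ?_, fun i m _ ↦ ?_⟩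
  · rw [energyDensityCoeff_eq_zero_of_isVacuumConstraintSolution e h]
    refine IsBigO.of_bound 0 (Eventually.of_forall fun x ↦ ?_)
    simp
  · rw [momentumDensityCoeff_eq_zero_of_isVacuumConstraintSolution e h i]
    refine IsBigO.of_bound 0 (Eventually.of_forall fun x ↦ ?_)
    simp

/-- **Admissible vacuum data have source decay of every positive rate** on every end (they solve
the vacuum constraints). Christodoulou, CQG 16 (1999), p. A24; Eichmair–Huang–Lee–Schoen 2016,
§2. [cite: Christodoulou1999, p. A24] -/
theorem hasSourceDecay_of_mem_admissibleVacuumData (e : AFEnd X) {D : InitialDataSet (𝓡 3) X}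
    [D.metric.HasLeviCivita] (hD : D ∈ admissibleVacuumData X) {q₀ : ℝ} (hq₀ : 0 < q₀) :
    HasSourceDecay e D q₀ :=
  hasSourceDecay_of_isVacuumConstraintSolution e hD.1.1 hq₀

/-- **Admissible vacuum data satisfy the dominant energy condition.**
Christodoulou, CQG 16 (1999), p. A24; Bartnik–Isenberg 2004, §2. [cite: Christodoulou1999, p. A24] -/
theorem satisfiesDominantEnergyCondition_of_mem_admissibleVacuumData {D : InitialDataSet (𝓡 3) X}
    [D.metric.HasLeviCivita] (hD : D ∈ admissibleVacuumData X) :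
    D.SatisfiesDominantEnergyCondition :=
  InitialDataSet.IsVacuumConstraintSolution.satisfiesDominantEnergyCondition hD.1.1

end Literature.Geometry.Lorentzian

end
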